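import Literature.Probability.LatticeModels.GridDomainHarmonicApproximation
import Literature.Probability.LatticeModels.GridDomainConformalGeometry
import Literature.Probability.LatticeModels.LatticeHarnackConformalLocal
import HarnessLib

/-!
# Nonnegative functions lattice-harmonic away from the boundary of grid domains, in conformal
# coordinates: uniform bounds, asymptotic equicontinuity, subsequential limits, harmonicity of the
# limit (the compactness half of LSW 2004, §5.2, for `h = H(·,u)/H(0,u)`)

Topic `Literature/Probability/LatticeModels`; the LOCAL companion of
`GridDomainHarmonicApproximation.lean`. That file carries out the compactness argument of
G. F. Lawler, O. Schramm, W. Werner, *Conformal invariance of planar loop-erased random walks and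
uniform spanning trees*, Ann. Probab. 32 (2004), Lemma 5.3 (arXiv math/0112234, Lemma 32) for
functions `h ≥ 0` lattice-harmonic at EVERY site of `V(D)`. The proof of Prop. 2.2 of the paper
(§5.2) needs the same machinery for `h = H(·,u)/H(0,u) = G(·,q)/G(0,q)`, which is harmonic at
every site except the site `q` adjacent to the boundary (the pole of the killed Green function),
and the printed compactness argument only uses harmonicity on compact subsets of conformal
coordinates ("If `K ⊂ 𝕌` is compact, then Lemma 5.2 shows that there is a constant `C > 0` such
that for all sufficiently large `n` … the discrete derivatives … are bounded by `C` in
`φ(K) ∩ δ V_{D_n}`"). This file records the machinery under the hypothesis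

  `h` is lattice-harmonic at every site `x` with `B(x, 64) ⊆ D`

(which `G(·, q)/G(0,q)` satisfies, the pole being within distance `1` of the complement), with the
same statements and constants:

* `LSWGrid.sample_le_local`, `LSWGrid.abs_step_le_of_norm_sub_lt_local`,
  `LSWGrid.abs_sample_sub_sample_le_local`, `LSWGrid.exists_equicontinuity_const_local` (through
  the local conformal Harnack/Lipschitz bounds `harnack_conformal_local`,
  `lipschitz_conformal_local` of `LatticeHarnackConformalLocal.lean`);
* `LSWGrid.exists_subseq_tendstoUniformlyOn_sample_local` — extraction of a subsequence along
  which the sampled functions converge uniformly on compacta of `𝔻` to a continuous function;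
* `LSWGrid.harmonicOnNhd_of_sample_limit_local` — the limit is harmonic on `𝔻` (mesh points of a
  compact piece of the limit picture are sites at conformal radius `< r' < 1`, which carry the disc
  `B(x, inrad·(1-r')²/32) ⊇ B(x, 64)` for large inner radius, `ball_subset_of_norm_le`).

The proofs are those of `GridDomainHarmonicApproximation.lean` verbatim except where the
harmonicity hypothesis is invoked. Everything is proved; no named fact.

## References

* G. F. Lawler, O. Schramm, W. Werner, Ann. Probab. 32 (2004), Lemma 5.2, Lemma 5.3, §5.2
  (arXiv pp. 27–29). [LawlerSchrammWerner2004]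
-/

noncomputable section

open Set Metric Filter
open scoped Topology

namespace Literature.Probability.LatticeModels

namespace LSWGrid

open Literature.Analysis.Complex

/-! ### One domain: the local toolkit -/

section OneDomain

variable {D : Set ℂ} (hD : IsClassD D) {ψ : ℂ → ℂ} (hψ : IsDiscMap D ψ)
include hD hψ

omit hD in
/-- The locality hypothesis of the conformal toolkit for `F = ψ⁻¹`: a site whose mesh point
carries the disc `B(x, 64) ⊆ F(𝔻) = D` is a site of `{x | B(x, 64) ⊆ D}`. [folklore] -/
theorem toolkit_hU_local :
    ∀ y : Site 2, ball (meshPoint 1 y) 64 ⊆ Function.invFunOn ψ D '' ball 0 1 →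
      y ∈ {x : Site 2 | ball (Site.toComplex x) 64 ⊆ D} := by
  intro y hy
  rwa [hψ.image_inv, meshPoint_one] at hy

/-- **The discrete gradient estimate in conformal coordinates near a conformal point, for
functions harmonic away from the boundary** (Lemma 5.2, `k = 1`, through
`lipschitz_conformal_local`): as `lipschitz_isDiscMap_near`, for `h ≥ 0` lattice-harmonic at the
sites `x` with `B(x, 64) ⊆ D`. [cite: LawlerSchrammWerner2004, Lemma 5.2] -/
theorem lipschitz_isDiscMap_near_local
    {h : Site 2 → ℝ} (hpos : ∀ w, 0 ≤ h w)
    (hh : IsLatticeHarmonicOn h {x : Site 2 | ball (Site.toComplex x) 64 ⊆ D})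
    {r : ℝ} (hr : r < 1) (hbig : 40000 ≤ infDist (0 : ℂ) Dᶜ * (1 - r) ^ 2)
    {N : ℕ} (hN : 352000 / (1 - r) ^ 5 ≤ N) {ζ : ℂ} (hζ : ‖ζ‖ ≤ r)
    {x : Site 2} (hx : ‖Site.toComplex x - Function.invFunOn ψ D ζ‖ ≤ 1) (k : Fin 4) :
    |h (x + cornerUnit k) - h x| ≤
      1024 * topGradConst * (2 / maneuverConst) ^ N * h 0 / (infDist (0 : ℂ) Dᶜ * (1 - r) ^ 2) := by
  have hopen : IsOpen D := hD.1.1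
  have hF0 : Function.invFunOn ψ D 0 = 0 := hψ.inv_zero hD.2.2.1
  have himg : Function.invFunOn ψ D '' ball 0 1 = D := hψ.image_inv
  obtain ⟨b, hbD, hbn⟩ := exists_notMem_norm_eq_inrad hD
  have hρ₀ := inrad_pos hD
  have hsub : ball (Function.invFunOn ψ D 0) (infDist (0 : ℂ) Dᶜ) ⊆
      Function.invFunOn ψ D '' ball 0 1 := by
    rw [hF0, himg]
    exact Metric.ball_infDist_compl_subset
  have hb : b ∉ Function.invFunOn ψ D '' ball 0 1 := by rwa [himg]
  have hbρ : ‖b - Function.invFunOn ψ D 0‖ ≤ 2 * infDist (0 : ℂ) Dᶜ := by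
    rw [hF0, sub_zero, hbn]
    linarith
  have hU := toolkit_hU_local hψ
  have hx' : ‖meshPoint 1 x - Function.invFunOn ψ D ζ‖ ≤ 1 := by rwa [meshPoint_one]
  have key := lipschitz_conformal_local (hψ.differentiableOn_inv hopen) hψ.injOn_inv hρ₀ hsub hb hbρ
    hpos hh hU hr hbig hN hζ hx' k
  rwa [hF0, nearestSite_one_zero] at key

/-- **Uniform bound on the sampled function** (Lemma 5.2, `k = 0`): for `h ≥ 0` lattice-harmonic
on `V(D)`, `r < 1` with `inrad(D)(1-r)² ≥ 10⁴` and `N ≥ 11000/(1-r)⁵`,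
`h(nearestSite 1 (ψ⁻¹ ζ)) ≤ (2/c_*)^N h(0)` for all `|ζ| ≤ r`. [cite: LawlerSchrammWerner2004, Lemma 5.2] -/
theorem sample_le_local {h : Site 2 → ℝ} (hpos : ∀ w, 0 ≤ h w)
    (hh : IsLatticeHarmonicOn h {x : Site 2 | ball (Site.toComplex x) 64 ⊆ D}) {r : ℝ} (hr : r < 1)
    (hbig : 10000 ≤ infDist (0 : ℂ) Dᶜ * (1 - r) ^ 2) {N : ℕ} (hN : 11000 / (1 - r) ^ 5 ≤ N)
    {ζ : ℂ} (hζ : ‖ζ‖ ≤ r) :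
    h (nearestSite 1 (Function.invFunOn ψ D ζ)) ≤ (2 / maneuverConst) ^ N * h 0 := by
  obtain ⟨hsub, ⟨b, hb, hbρ⟩, -⟩ := toolkit_hyps hD hψ
  have hU := toolkit_hU_local hψ
  have hρ₀ := inrad_pos hD
  have hbρ' : ‖b - Function.invFunOn ψ D 0‖ ≤ 2 * infDist (0 : ℂ) Dᶜ := by linarith
  have key := (harnack_conformal_local (hψ.differentiableOn_inv hD.1.1) hψ.injOn_inv hρ₀ hsub hb hbρ'
    hpos hh hU hr hbig hN hζ).2
  rw [hψ.inv_zero hD.2.2.1, nearestSite_one_zero] at key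
  have hc := maneuverConst_pos
  have hcN : 0 < (maneuverConst / 2) ^ N := by positivity
  rw [show (2 / maneuverConst) ^ N = ((maneuverConst / 2) ^ N)⁻¹ by
    rw [← inv_pow, inv_div]]
  rw [le_inv_mul_iff₀ hcN]
  exact key


/-- **Per-step gradient bound at sites Euclidean-close to `ψ⁻¹ ζ`** (Lemma 5.2, `k = 1`, at the
conformal radius `(1+r)/2`): for `h ≥ 0` lattice-harmonic on `V(D)`, `r < 1`,
`inrad(D)(1-r)² ≥ 1.6·10⁵`, `N ≥ 352000·32/(1-r)⁵`, `|ζ| ≤ r` and a site `y` with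
`|y - ψ⁻¹ ζ| < inrad(D)(1-r)²/64`:
`|h(y + e_k) - h(y)| ≤ 4096 C_top (2/c_*)^N h(0)/(inrad(D)(1-r)²)`. [cite: LawlerSchrammWerner2004, Lemma 5.2] -/
theorem abs_step_le_of_norm_sub_lt_local {h : Site 2 → ℝ} (hpos : ∀ w, 0 ≤ h w)
    (hh : IsLatticeHarmonicOn h {x : Site 2 | ball (Site.toComplex x) 64 ⊆ D}) {r : ℝ} (hr : r < 1)
    (hbig : 160000 ≤ infDist (0 : ℂ) Dᶜ * (1 - r) ^ 2) {N : ℕ}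
    (hN : 352000 * 32 / (1 - r) ^ 5 ≤ N) {ζ : ℂ} (hζ : ‖ζ‖ ≤ r) {y : Site 2}
    (hy : ‖Site.toComplex y - Function.invFunOn ψ D ζ‖ < infDist (0 : ℂ) Dᶜ * (1 - r) ^ 2 / 64)
    (k : Fin 4) :
    |h (y + cornerUnit k) - h y| ≤
      4096 * topGradConst * (2 / maneuverConst) ^ N * h 0 / (infDist (0 : ℂ) Dᶜ * (1 - r) ^ 2) := by
  obtain ⟨ζ', hζ', hFζ'⟩ := exists_coord_of_norm_sub_lt hD hψ hr hζ hy
  have h1r : 0 < 1 - r := by linarith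
  have hr' : (1 + r) / 2 < 1 := by linarith
  have h1r' : 1 - (1 + r) / 2 = (1 - r) / 2 := by ring
  have hbig' : 40000 ≤ infDist (0 : ℂ) Dᶜ * (1 - (1 + r) / 2) ^ 2 := by
    rw [h1r']
    nlinarith [hbig]
  have hN' : 352000 / (1 - (1 + r) / 2) ^ 5 ≤ N := by
    rw [h1r']
    have : (352000 : ℝ) / ((1 - r) / 2) ^ 5 = 352000 * 32 / (1 - r) ^ 5 := by
      field_simp
      ring
    rw [this]
    exact hN
  have hx : ‖Site.toComplex y - Function.invFunOn ψ D ζ'‖ ≤ 1 := by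
    rw [hFζ', sub_self, norm_zero]
    exact zero_le_one
  have key := lipschitz_isDiscMap_near_local hD hψ hpos hh hr' hbig' hN' hζ' hx k
  rw [h1r'] at key
  convert key using 1
  field_simp
  ring


/-- **Variation of `h` between two sampled sites** (the `ℓ¹` staircase inside a Koebe ball): with
`h`, `r`, `N` as in `abs_step_le_of_norm_sub_lt_local`, `|ζ|, |ζ'| ≤ r`, and
`|ψ⁻¹ ζ' - ψ⁻¹ ζ| ≤ T` with `2T + 8 ≤ inrad(D)(1-r)²/64`:
`|h(site ψ⁻¹ζ') - h(site ψ⁻¹ζ)| ≤ g · 2 (T + 2)`, where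
`g = 4096 C_top (2/c_*)^N h(0)/(inrad(D)(1-r)²)` is the per-step bound.
[cite: LawlerSchrammWerner2004, Lemma 5.3] -/
theorem abs_sample_sub_sample_le_local {h : Site 2 → ℝ} (hpos : ∀ w, 0 ≤ h w)
    (hh : IsLatticeHarmonicOn h {x : Site 2 | ball (Site.toComplex x) 64 ⊆ D}) {r : ℝ} (hr : r < 1)
    (hbig : 160000 ≤ infDist (0 : ℂ) Dᶜ * (1 - r) ^ 2) {N : ℕ}
    (hN : 352000 * 32 / (1 - r) ^ 5 ≤ N) {ζ ζ' : ℂ} (hζ : ‖ζ‖ ≤ r)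
    {T : ℝ} (hFT : ‖Function.invFunOn ψ D ζ' - Function.invFunOn ψ D ζ‖ ≤ T)
    (hT : 2 * T + 8 ≤ infDist (0 : ℂ) Dᶜ * (1 - r) ^ 2 / 64) :
    |h (nearestSite 1 (Function.invFunOn ψ D ζ')) - h (nearestSite 1 (Function.invFunOn ψ D ζ))| ≤
      4096 * topGradConst * (2 / maneuverConst) ^ N * h 0 / (infDist (0 : ℂ) Dᶜ * (1 - r) ^ 2) *
        (2 * (T + 2)) := by
  set F := Function.invFunOn ψ D with hF
  set x : Site 2 := nearestSite 1 (F ζ) with hx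
  set x' : Site 2 := nearestSite 1 (F ζ') with hx'
  set g : ℝ := 4096 * topGradConst * (2 / maneuverConst) ^ N * h 0 /
    (infDist (0 : ℂ) Dᶜ * (1 - r) ^ 2) with hg
  have h1r : 0 < 1 - r := by linarith
  have hρ₀ := inrad_pos hD
  have hg0 : 0 ≤ g := by
    have := topGradConst_pos
    have := maneuverConst_pos
    have := hpos 0
    positivity
  have hxF : ‖Site.toComplex x - F ζ‖ ≤ 1 := norm_toComplex_nearestSite_sub_le _
  have hx'F : ‖Site.toComplex x' - F ζ'‖ ≤ 1 := norm_toComplex_nearestSite_sub_le _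
  have hXX : ‖Site.toComplex x' - Site.toComplex x‖ ≤ T + 2 := by
    calc ‖Site.toComplex x' - Site.toComplex x‖
        = ‖(Site.toComplex x' - F ζ') + (F ζ' - F ζ) + (F ζ - Site.toComplex x)‖ := by ring_nf
      _ ≤ ‖Site.toComplex x' - F ζ'‖ + ‖F ζ' - F ζ‖ + ‖F ζ - Site.toComplex x‖ :=
          norm_add₃_le
      _ ≤ 1 + T + 1 := by rw [norm_sub_rev (F ζ)]; linarith
      _ = T + 2 := by ring
  -- the sup-norm box of integer radius `⌈T + 2⌉` about `x`
  set Rb : ℤ := ⌈T + 2⌉ with hRb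
  have hRbT : (T + 2 : ℝ) ≤ Rb := Int.le_ceil _
  have hRbT' : (Rb : ℝ) < T + 3 := by
    have := Int.ceil_lt_add_one (T + 2)
    linarith
  have hcoord : ∀ z : Site 2, ∀ i : Fin 2,
      |((z i - x i : ℤ) : ℝ)| ≤ ‖Site.toComplex z - Site.toComplex x‖ := by
    intro z i
    fin_cases i
    · have := Complex.abs_re_le_norm (Site.toComplex z - Site.toComplex x)
      simpa using this
    · have := Complex.abs_im_le_norm (Site.toComplex z - Site.toComplex x)
      simpa using this
  have hint : ∀ z : Site 2, ∀ i : Fin 2, ‖Site.toComplex z - Site.toComplex x‖ ≤ T + 2 →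
      |z i - x i| ≤ Rb := by
    intro z i hz
    have h1 : |((z i - x i : ℤ) : ℝ)| ≤ Rb := ((hcoord z i).trans hz).trans hRbT
    rw [← Int.cast_abs] at h1
    exact_mod_cast h1
  -- every site of the box is Euclidean-close to `F ζ`, so the per-step bound holds there
  have hstep : ∀ z : Site 2, |z 0 - x 0| ≤ Rb → |z 1 - x 1| ≤ Rb →
      ∀ k : Fin 4, |h (z + cornerUnit k) - h z| ≤ g := by
    intro z h0 h1 k
    have h0' : |((z 0 - x 0 : ℤ) : ℝ)| ≤ Rb := by rw [← Int.cast_abs]; exact_mod_cast h0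
    have h1' : |((z 1 - x 1 : ℤ) : ℝ)| ≤ Rb := by rw [← Int.cast_abs]; exact_mod_cast h1
    have hZX : ‖Site.toComplex z - Site.toComplex x‖ < 2 * T + 6 := by
      refine (Complex.norm_le_abs_re_add_abs_im _).trans_lt ?_
      have hre : |(Site.toComplex z - Site.toComplex x).re| = |((z 0 - x 0 : ℤ) : ℝ)| := by simp
      have him : |(Site.toComplex z - Site.toComplex x).im| = |((z 1 - x 1 : ℤ) : ℝ)| := by simp
      rw [hre, him]
      linarith
    have hZF : ‖Site.toComplex z - F ζ‖ < infDist (0 : ℂ) Dᶜ * (1 - r) ^ 2 / 64 := by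
      calc ‖Site.toComplex z - F ζ‖ = ‖(Site.toComplex z - Site.toComplex x) + (Site.toComplex x - F ζ)‖ := by
            rw [sub_add_sub_cancel]
        _ ≤ ‖Site.toComplex z - Site.toComplex x‖ + ‖Site.toComplex x - F ζ‖ := norm_add_le _ _
        _ < 2 * T + 6 + 1 := by linarith
        _ ≤ infDist (0 : ℂ) Dᶜ * (1 - r) ^ 2 / 64 := by linarith
    exact abs_step_le_of_norm_sub_lt_local hD hψ hpos hh hr hbig hN hζ hZF k
  have h0 : |x' 0 - x 0| ≤ Rb := hint x' 0 hXX
  have h1 : |x' 1 - x 1| ≤ Rb := hint x' 1 hXX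
  have key := abs_sub_le_of_gradient hstep h0 h1
  refine key.trans ?_
  refine mul_le_mul_of_nonneg_left ?_ hg0
  have ha := (hcoord x' 0).trans hXX
  have hb := (hcoord x' 1).trans hXX
  linarith


end OneDomain

/-! ### Asymptotic equicontinuity, uniformly over `𝔇` -/


/-- **Asymptotic equicontinuity of the sampled function, uniformly over the class `𝔇`.** For
`0 ≤ r < 1` there is a constant `L = L(r) ≥ 0` such that for every `D ∈ 𝔇` with
`inrad(D)(1-r)² ≥ 1.6·10⁵`, every disc map `ψ` of `D` and every `h ≥ 0` lattice-harmonic on `V(D)`,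
`|h(nearestSite 1 (ψ⁻¹ζ)) - h(nearestSite 1 (ψ⁻¹ζ'))| ≤ L h(0) (|ζ - ζ'| + 1/inrad(D))` for all
`|ζ|, |ζ'| ≤ r` (nearby pairs by the staircase bound, distant pairs by the uniform bound).
[cite: LawlerSchrammWerner2004, Lemma 5.3] -/
theorem exists_equicontinuity_const_local {r : ℝ} (hr0 : 0 ≤ r) (hr : r < 1) :
    ∃ L : ℝ, 0 ≤ L ∧ ∀ (D : Set ℂ), IsClassD D → ∀ (ψ : ℂ → ℂ), IsDiscMap D ψ →
      ∀ (h : Site 2 → ℝ), (∀ w, 0 ≤ h w) → IsLatticeHarmonicOn h {x : Site 2 | ball (Site.toComplex x) 64 ⊆ D} →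
      160000 ≤ infDist (0 : ℂ) Dᶜ * (1 - r) ^ 2 →
      ∀ ζ ζ' : ℂ, ‖ζ‖ ≤ r → ‖ζ'‖ ≤ r →
        |h (nearestSite 1 (Function.invFunOn ψ D ζ)) -
            h (nearestSite 1 (Function.invFunOn ψ D ζ'))| ≤
          L * h 0 * (‖ζ - ζ'‖ + (infDist (0 : ℂ) Dᶜ)⁻¹) := by
  have h1r : 0 < 1 - r := by linarith
  have hc := maneuverConst_pos
  have hK := topGradConst_pos
  -- the exponents of Lemma 5.2
  set N₀ : ℕ := ⌈(11000 : ℝ) / (1 - r) ^ 5⌉₊ with hN₀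
  set N₁ : ℕ := ⌈(352000 * 32 : ℝ) / (1 - r) ^ 5⌉₊ with hN₁
  have hN₀' : (11000 : ℝ) / (1 - r) ^ 5 ≤ N₀ := Nat.le_ceil _
  have hN₁' : (352000 * 32 : ℝ) / (1 - r) ^ 5 ≤ N₁ := Nat.le_ceil _
  -- constants: per-step `A h0 / R`, Euclidean/conformal ratio `M R`, sup bound `B h0`, threshold `κ`
  set A : ℝ := 4096 * topGradConst * (2 / maneuverConst) ^ N₁ / (1 - r) ^ 2 with hA
  set M : ℝ := 8 / (1 - r) ^ 3 with hM
  set B : ℝ := (2 / maneuverConst) ^ N₀ with hB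
  set κ : ℝ := (1 - r) ^ 5 / 2048 with hκ
  have hA0 : 0 ≤ A := by positivity
  have hM8 : 8 ≤ M := by
    rw [hM, le_div_iff₀ (by positivity)]
    have : (1 - r) ^ 3 ≤ 1 := pow_le_one₀ h1r.le (by linarith)
    nlinarith
  have hM0 : 0 < M := by linarith
  have hB0 : 0 ≤ B := by positivity
  have hκ0 : 0 < κ := by positivity
  refine ⟨2 * A * M + 2 * B / κ, by positivity, ?_⟩
  intro D hD ψ hψ h hpos hh hbig ζ ζ' hζ hζ'
  set R : ℝ := infDist (0 : ℂ) Dᶜ with hR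
  have hR0 : 0 < R := inrad_pos hD
  have h00 : 0 ≤ h 0 := hpos 0
  have hbig₀ : 10000 ≤ R * (1 - r) ^ 2 := by linarith
  -- Euclidean displacement
  have hdisp : ‖Function.invFunOn ψ D ζ' - Function.invFunOn ψ D ζ‖ ≤ M * R * ‖ζ - ζ'‖ := by
    have h1 := norm_inv_sub_inv_le hD hψ hr hζ' hζ
    rw [norm_sub_rev ζ' ζ] at h1
    convert h1 using 1
    rw [hM, hR]
    ring
  by_cases hnear : 2 * (M * R * ‖ζ - ζ'‖) + 8 ≤ R * (1 - r) ^ 2 / 64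
  · -- nearby pair: staircase bound
    have key := abs_sample_sub_sample_le_local hD hψ hpos hh hr hbig hN₁' hζ hdisp hnear
    rw [abs_sub_comm] at key
    refine key.trans ?_
    have hcalc : 4096 * topGradConst * (2 / maneuverConst) ^ N₁ * h 0 / (R * (1 - r) ^ 2) *
        (2 * (M * R * ‖ζ - ζ'‖ + 2)) = 2 * A * h 0 * (M * ‖ζ - ζ'‖ + 2 * R⁻¹) := by
      rw [hA]
      field_simp
    rw [hcalc]
    have h2 : M * ‖ζ - ζ'‖ + 2 * R⁻¹ ≤ M * (‖ζ - ζ'‖ + R⁻¹) := by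
      rw [mul_add]
      have : 2 * R⁻¹ ≤ M * R⁻¹ := mul_le_mul_of_nonneg_right (by linarith) (by positivity)
      linarith
    calc 2 * A * h 0 * (M * ‖ζ - ζ'‖ + 2 * R⁻¹) ≤ 2 * A * h 0 * (M * (‖ζ - ζ'‖ + R⁻¹)) :=
          mul_le_mul_of_nonneg_left h2 (by positivity)
      _ = 2 * A * M * h 0 * (‖ζ - ζ'‖ + R⁻¹) := by ring
      _ ≤ (2 * A * M + 2 * B / κ) * h 0 * (‖ζ - ζ'‖ + R⁻¹) := by
          have : 0 ≤ 2 * B / κ * h 0 * (‖ζ - ζ'‖ + R⁻¹) := by positivity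
          nlinarith
  · -- distant pair: `‖ζ - ζ'‖ ≥ κ`, use the uniform bound twice
    push Not at hnear
    have hfar : κ ≤ ‖ζ - ζ'‖ := by
      -- `R(1-r)²/64 - 8 ≥ R(1-r)²/128` since `R(1-r)² ≥ 1024`
      have h1 : R * (1 - r) ^ 2 / 128 ≤ 2 * (M * R * ‖ζ - ζ'‖) := by linarith
      -- `κ = (1-r)²/(256 M)`:  `(1-r)^5/2048 * (2 * M) = (1-r)²/128 * ... `
      have h2 : R * (1 - r) ^ 2 / 128 = 2 * (M * R * κ) := by
        rw [hM, hκ]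
        field_simp
        ring
      rw [h2] at h1
      have h3 : 0 < 2 * (M * R) := by positivity
      nlinarith
    have hu := sample_le_local hD hψ hpos hh hr hbig₀ hN₀' hζ
    have hu' := sample_le_local hD hψ hpos hh hr hbig₀ hN₀' hζ'
    have hnn := hpos (nearestSite 1 (Function.invFunOn ψ D ζ))
    have hnn' := hpos (nearestSite 1 (Function.invFunOn ψ D ζ'))
    have habs : |h (nearestSite 1 (Function.invFunOn ψ D ζ)) -
        h (nearestSite 1 (Function.invFunOn ψ D ζ'))| ≤ 2 * B * h 0 := by
      rw [abs_le]
      constructor <;> linarith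
    refine habs.trans ?_
    have h4 : 2 * B * h 0 ≤ 2 * B / κ * h 0 * ‖ζ - ζ'‖ := by
      have : 2 * B * h 0 = 2 * B / κ * h 0 * κ := by field_simp
      rw [this]
      exact mul_le_mul_of_nonneg_left hfar (by positivity)
    calc 2 * B * h 0 ≤ 2 * B / κ * h 0 * ‖ζ - ζ'‖ := h4
      _ ≤ 2 * B / κ * h 0 * (‖ζ - ζ'‖ + R⁻¹) := by
          refine mul_le_mul_of_nonneg_left ?_ (by positivity)
          linarith [inv_nonneg.2 hR0.le]
      _ ≤ (2 * A * M + 2 * B / κ) * h 0 * (‖ζ - ζ'‖ + R⁻¹) := by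
          have : 0 ≤ 2 * A * M * h 0 * (‖ζ - ζ'‖ + R⁻¹) := by positivity
          nlinarith

/-! ### Extraction of a continuous subsequential limit in conformal coordinates -/


/-! ### Extraction along a subsequence -/


/-- **Extraction (the Arzelà–Ascoli step of Lemma 5.3, in conformal coordinates).** Let
`D_n ∈ 𝔇` with disc maps `ψ_n`, `h_n ≥ 0` lattice-harmonic on `V(D_n)` with `h_n(0) = 1`, and
`inrad(D_n) → ∞`. Then along a subsequence the sampled functions
`ζ ↦ h_n(nearestSite 1 (ψ_n⁻¹ ζ))` converge uniformly on every compact subset of `𝔻` to a function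
continuous on `𝔻` (uniform bound `sample_le_local`, asymptotic equicontinuity
`exists_equicontinuity_const_local`, and `exists_subseq_tendstoUniformlyOn_of_asympEquicontinuous`).
[cite: LawlerSchrammWerner2004, Lemma 5.3] -/
theorem exists_subseq_tendstoUniformlyOn_sample_local {Dn : ℕ → Set ℂ} (hDn : ∀ n, IsClassD (Dn n))
    {ψn : ℕ → ℂ → ℂ} (hψn : ∀ n, IsDiscMap (Dn n) (ψn n)) {hn : ℕ → Site 2 → ℝ}
    (hpos : ∀ n w, 0 ≤ hn n w) (hharm : ∀ n, IsLatticeHarmonicOn (hn n) {x : Site 2 | ball (Site.toComplex x) 64 ⊆ Dn n})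
    (h0 : ∀ n, hn n 0 = 1) (hR : Tendsto (fun n => infDist (0 : ℂ) (Dn n)ᶜ) atTop atTop) :
    ∃ φ : ℕ → ℕ, StrictMono φ ∧ ∃ g : ℂ → ℝ, ContinuousOn g (ball 0 1) ∧
      ∀ K ⊆ ball (0 : ℂ) 1, IsCompact K →
        TendstoUniformlyOn
          (fun n ζ => hn (φ n) (nearestSite 1 (Function.invFunOn (ψn (φ n)) (Dn (φ n)) ζ)))
          g atTop K := by
  -- the sampled functions as complex-valued functions, and the vanishing scale `1/inrad(D_n)`
  set u : ℕ → ℂ → ℂ := fun n ζ =>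
    ((hn n (nearestSite 1 (Function.invFunOn (ψn n) (Dn n) ζ)) : ℝ) : ℂ) with hu
  set ε : ℕ → ℝ := fun n => (infDist (0 : ℂ) (Dn n)ᶜ)⁻¹ with hε
  have hε0 : Tendsto ε atTop (𝓝 0) := tendsto_inv_atTop_zero.comp hR
  -- eventual uniform bound on compacta
  have hbdd : ∀ K ⊆ ball (0 : ℂ) 1, IsCompact K → ∃ M : ℝ, ∀ᶠ n in atTop, ∀ z ∈ K, ‖u n z‖ ≤ M := by
    intro K hK1 hK
    obtain ⟨r, hr0, hr1, hKr⟩ := exists_subset_closedBall_of_isCompact hK hK1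
    have h1r : 0 < 1 - r := by linarith
    set N₀ : ℕ := ⌈(11000 : ℝ) / (1 - r) ^ 5⌉₊ with hN₀
    have hN₀' : (11000 : ℝ) / (1 - r) ^ 5 ≤ N₀ := Nat.le_ceil _
    refine ⟨(2 / maneuverConst) ^ N₀, ?_⟩
    filter_upwards [hR.eventually_ge_atTop (10000 / (1 - r) ^ 2)] with n hn' z hz
    have hbig : 10000 ≤ infDist (0 : ℂ) (Dn n)ᶜ * (1 - r) ^ 2 := by
      rw [div_le_iff₀ (by positivity)] at hn'
      exact hn'
    have hζ : ‖z‖ ≤ r := mem_closedBall_zero_iff.1 (hKr hz)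
    have key := sample_le_local (hDn n) (hψn n) (hpos n) (hharm n) hr1 hbig hN₀' hζ
    rw [h0 n, mul_one] at key
    rw [hu]
    simp only [Complex.norm_real, Real.norm_eq_abs, abs_of_nonneg (hpos n _)]
    exact key
  -- eventual asymptotic equicontinuity on compacta
  have hequi : ∀ K ⊆ ball (0 : ℂ) 1, IsCompact K → ∃ L : ℝ, 0 ≤ L ∧ ∀ᶠ n in atTop,
      ∀ z ∈ K, ∀ z' ∈ K, ‖u n z - u n z'‖ ≤ L * (‖z - z'‖ + ε n) := by
    intro K hK1 hK
    obtain ⟨r, hr0, hr1, hKr⟩ := exists_subset_closedBall_of_isCompact hK hK1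
    have h1r : 0 < 1 - r := by linarith
    obtain ⟨L, hL0, hL⟩ := exists_equicontinuity_const_local hr0 hr1
    refine ⟨L, hL0, ?_⟩
    filter_upwards [hR.eventually_ge_atTop (160000 / (1 - r) ^ 2)] with n hn' z hz z' hz'
    have hbig : 160000 ≤ infDist (0 : ℂ) (Dn n)ᶜ * (1 - r) ^ 2 := by
      rw [div_le_iff₀ (by positivity)] at hn'
      exact hn'
    have key := hL (Dn n) (hDn n) (ψn n) (hψn n) (hn n) (hpos n) (hharm n) hbig z z'
      (mem_closedBall_zero_iff.1 (hKr hz)) (mem_closedBall_zero_iff.1 (hKr hz'))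
    rw [h0 n, mul_one] at key
    rw [hu, hε]
    simp only [← Complex.ofReal_sub, Complex.norm_real, Real.norm_eq_abs]
    exact key
  obtain ⟨φ, hφ, g, hgc, hg⟩ :=
    exists_subseq_tendstoUniformlyOn_of_asympEquicontinuous isOpen_ball u ε hε0 hbdd hequi
  refine ⟨φ, hφ, fun ζ => (g ζ).re, Complex.continuous_re.comp_continuousOn hgc, ?_⟩
  intro K hK1 hK
  have h := hg K hK1 hK
  rw [Metric.tendstoUniformlyOn_iff] at h ⊢
  intro δ hδ
  filter_upwards [h δ hδ] with n hn' ζ hζ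
  have h1 := hn' ζ hζ
  rw [dist_eq_norm] at h1
  rw [Real.dist_eq]
  refine lt_of_le_of_lt ?_ h1
  have h2 : (g ζ).re - hn (φ n) (nearestSite 1 (Function.invFunOn (ψn (φ n)) (Dn (φ n)) ζ)) =
      (g ζ - u (φ n) ζ).re := by
    rw [hu]
    simp
  rw [h2]
  exact Complex.abs_re_le_norm _


/-! ### The subsequential limit is harmonic -/


/-- **The subsequential limit in conformal coordinates is harmonic** (the "`h*` is harmonic" step
of Lemma 5.3, arXiv p. 28: "The fact that `h^n` is discrete-harmonic translates to
`(∂_x^δ)² h^n(v-δ) + (∂_y^δ)² h^n(v-iδ) = 0`. Therefore [the convergence of discrete derivatives]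
shows that `h*` is harmonic"; here via the tree's consistency-and-stability theorem
`harmonicOnNhd_of_latticeHarmonic_limit` in the Euclidean picture of a Montel limit `Φ` of
`ψ_n⁻¹/inrad(D_n)`). Let `D_n ∈ 𝔇` with disc maps `ψ_n`, `h_n ≥ 0` lattice-harmonic on `V(D_n)`,
`inrad(D_n) → ∞`, and suppose the sampled functions `ζ ↦ h_n(nearestSite 1 (ψ_n⁻¹ ζ))` converge
uniformly on compact subsets of `𝔻` to `g`, continuous on `𝔻`. Then `g` is harmonic on `𝔻`.
[cite: LawlerSchrammWerner2004, Lemma 5.3] -/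
theorem harmonicOnNhd_of_sample_limit_local {Dn : ℕ → Set ℂ} (hDn : ∀ n, IsClassD (Dn n))
    {ψn : ℕ → ℂ → ℂ} (hψn : ∀ n, IsDiscMap (Dn n) (ψn n)) {hn : ℕ → Site 2 → ℝ}
    (hharm : ∀ n, IsLatticeHarmonicOn (hn n) {x : Site 2 | ball (Site.toComplex x) 64 ⊆ Dn n})
    (hR : Tendsto (fun n => infDist (0 : ℂ) (Dn n)ᶜ) atTop atTop)
    {g : ℂ → ℝ} (hgc : ContinuousOn g (ball 0 1))
    (hg : ∀ K ⊆ ball (0 : ℂ) 1, IsCompact K →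
      TendstoUniformlyOn
        (fun n ζ => hn n (nearestSite 1 (Function.invFunOn (ψn n) (Dn n) ζ))) g atTop K) :
    InnerProductSpace.HarmonicOnNhd g (ball 0 1) := by
  -- notation
  set R : ℕ → ℝ := fun n => infDist (0 : ℂ) (Dn n)ᶜ with hRdef
  set F : ℕ → ℂ → ℂ := fun n => Function.invFunOn (ψn n) (Dn n) with hFdef
  set G : ℕ → ℂ → ℂ := fun n ζ => ((R n : ℝ) : ℂ)⁻¹ * F n ζ with hGdef
  have hRpos : ∀ n, 0 < R n := fun n => inrad_pos (hDn n)
  have hGp : ∀ n, DifferentiableOn ℂ (G n) (ball 0 1) ∧ InjOn (G n) (ball 0 1) ∧ G n 0 = 0 ∧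
      1 ≤ ‖deriv (G n) 0‖ ∧ ‖deriv (G n) 0‖ ≤ 4 := fun n => scaledInv_props (hDn n) (hψn n)
  -- Montel: a univalent locally uniform limit `Φ` of a subsequence of the rescaled inverse maps
  obtain ⟨φ, hφ, Φ, hΦd, hΦinj, -, -, -, hlim, -⟩ :=
    exists_subseq_tendstoLocallyUniformlyOn_univalent (fun n => (hGp n).1) (fun n => (hGp n).2.1)
      (fun n => (hGp n).2.2.1) one_pos (fun n => (hGp n).2.2.2.1) (fun n => (hGp n).2.2.2.2)
  -- the limit domain and the inverse of `Φ`
  set Ω : Set ℂ := Φ '' ball 0 1 with hΩdef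
  have hΩ : IsOpen Ω := SCV.isOpen_image_of_injOn rfl hΦd isOpen_ball hΦinj
  set Φi : ℂ → ℂ := Function.invFunOn Φ (ball 0 1) with hΦidef
  have hΦi_d : DifferentiableOn ℂ Φi Ω :=
    Complex.differentiableOn_invFunOn_image isOpen_ball hΦd hΦinj
      (fun z hz => SCV.deriv_ne_zero_of_injOn hΦd isOpen_ball hΦinj hz)
  have hΦi_c : ContinuousOn Φi Ω := hΦi_d.continuousOn
  have hleft : ∀ ζ ∈ ball (0 : ℂ) 1, Φi (Φ ζ) = ζ := fun ζ hζ => hΦinj.leftInvOn_invFunOn hζ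
  have hright : ∀ z ∈ Ω, Φ (Φi z) = z := fun z hz => (surjOn_image Φ (ball 0 1)).rightInvOn_invFunOn hz
  have hmaps : MapsTo Φi Ω (ball 0 1) := (surjOn_image Φ (ball 0 1)).mapsTo_invFunOn
  -- `H = g ∘ Φ⁻¹`
  set H : ℂ → ℝ := fun z => g (Φi z) with hHdef
  have hHc : ContinuousOn H Ω := hgc.comp hΦi_c hmaps
  -- uniform convergence of `G ∘ φ` to `Φ` on compacta, and along shifted subsequences
  have hGunif : ∀ K ⊆ ball (0 : ℂ) 1, IsCompact K →
      TendstoUniformlyOn (fun n => G (φ n)) Φ atTop K :=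
    (tendstoLocallyUniformlyOn_iff_forall_isCompact isOpen_ball).1 hlim
  -- `H` is harmonic on `Ω`
  have hH : InnerProductSpace.HarmonicOnNhd H Ω := by
    intro z₀ hz₀
    obtain ⟨ρ', hρ', hballΩ⟩ := Metric.isOpen_iff.1 hΩ z₀ hz₀
    set ρ : ℝ := ρ' / 2 with hρdef
    have hρ : 0 < ρ := by positivity
    have hKΩ : closedBall z₀ ρ ⊆ Ω := (closedBall_subset_ball (by linarith)).trans hballΩ
    suffices hsuff : InnerProductSpace.HarmonicOnNhd H (ball z₀ ρ) from hsuff z₀ (mem_ball_self hρ)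
    -- conformal coordinates of the closed disc: a compact `L' ⊆ closedBall 0 r₁`, `r₁ < 1`
    set K : Set ℂ := closedBall z₀ ρ with hKdef
    have hKc : IsCompact K := isCompact_closedBall _ _
    have hL'c : IsCompact (Φi '' K) := hKc.image_of_continuousOn (hΦi_c.mono hKΩ)
    have hL'1 : Φi '' K ⊆ ball 0 1 := (hmaps.mono_left hKΩ).image_subset
    obtain ⟨r₁, hr₁0, hr₁1, hL'r⟩ := exists_subset_closedBall_of_isCompact hL'c hL'1
    set r' : ℝ := (1 + r₁) / 2 with hr'def
    have hr'1 : r' < 1 := by rw [hr'def]; linarith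
    have hr₁r' : r₁ < r' := by rw [hr'def]; linarith
    have hcb' : closedBall (0 : ℂ) r' ⊆ ball 0 1 := closedBall_subset_ball hr'1
    have hKΦ : K ⊆ Φ '' closedBall 0 r₁ := fun z hz => ⟨Φi z, hL'r ⟨z, hz, rfl⟩, hright z (hKΩ hz)⟩
    -- kernel inclusion: eventually `Φ(B̄ r₁) ⊆ G_{φ k}(B r')`
    have hK3 : ∀ᶠ k in atTop, Φ '' closedBall 0 r₁ ⊆ G (φ k) '' ball 0 r' :=
      eventually_image_closedBall_subset_image (Eventually.of_forall fun k => (hGp (φ k)).1)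
        hΦd.continuousOn hΦinj hlim hr₁0 hr₁r' hr'1
    -- and eventually the inner radius is large enough for a margin `64` at conformal radius `r'`
    have hK4 : ∀ᶠ k in atTop, 2048 / (1 - r') ^ 2 ≤ R (φ k) :=
      (hR.comp hφ.tendsto_atTop).eventually_ge_atTop _
    obtain ⟨N₀, hN₀⟩ := eventually_atTop.1 (hK3.and hK4)
    -- the shifted subsequence `ι m = φ (m + N₀)`
    set ι : ℕ → ℕ := fun m => φ (m + N₀) with hιdef
    have hι : Tendsto ι atTop atTop := hφ.tendsto_atTop.comp (tendsto_add_atTop_nat N₀)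
    have hincl : ∀ m, K ⊆ G (ι m) '' ball 0 r' := fun m =>
      hKΦ.trans (hN₀ (m + N₀) (Nat.le_add_left _ _)).1
    have hbigR : ∀ m, 2048 / (1 - r') ^ 2 ≤ R (ι m) := fun m => (hN₀ (m + N₀) (Nat.le_add_left _ _)).2
    set δ : ℕ → ℝ := fun m => (R (ι m))⁻¹ with hδdef
    have hδ : ∀ m, 0 < δ m := fun m => inv_pos.2 (hRpos _)
    have hδ0 : Tendsto δ atTop (𝓝 0) := tendsto_inv_atTop_zero.comp (hR.comp hι)
    -- mesh points of `K` are rescaled lattice points of `D`, with conformal coordinate in `B r'`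
    have hmesh : ∀ m (v : Site 2), meshPoint (δ m) v ∈ K →
        ∃ ζ : ℂ, ‖ζ‖ < r' ∧ F (ι m) ζ = Site.toComplex v ∧ G (ι m) ζ = meshPoint (δ m) v := by
      intro m v hv
      obtain ⟨ζ, hζ, hGζ⟩ := hincl m hv
      refine ⟨ζ, mem_ball_zero_iff.1 hζ, ?_, hGζ⟩
      have hRc : ((R (ι m) : ℝ) : ℂ) ≠ 0 := Complex.ofReal_ne_zero.2 (hRpos _).ne'
      have h1 : ((R (ι m) : ℝ) : ℂ)⁻¹ * F (ι m) ζ = ((R (ι m) : ℝ) : ℂ)⁻¹ * Site.toComplex v := by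
        have h2 : G (ι m) ζ = ((R (ι m) : ℝ) : ℂ)⁻¹ * F (ι m) ζ := rfl
        rw [← h2, hGζ, meshPoint, hδdef, Complex.ofReal_inv]
      exact mul_left_cancel₀ (inv_ne_zero hRc) h1
    have hvert : ∀ m (v : Site 2), meshPoint (δ m) v ∈ K → ball (Site.toComplex v) 64 ⊆ Dn (ι m) := by
      intro m v hv
      obtain ⟨ζ, hζ, hFζ, -⟩ := hmesh m v hv
      have hζb : ζ ∈ ball (0 : ℂ) 1 := mem_ball_zero_iff.2 (hζ.trans hr'1)
      have h1 : F (ι m) ζ ∈ Dn (ι m) := (hψn (ι m)).mapsTo_inv hζb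
      have h1r' : 0 < 1 - r' := by linarith
      have hnorm : ‖ψn (ι m) (F (ι m) ζ)‖ ≤ 1 - (1 - r') := by
        rw [(hψn (ι m)).rightInvOn hζb]; linarith [hζ.le]
      have hball := ball_subset_of_norm_le (hDn (ι m)) (hψn (ι m)) h1 h1r' hnorm
      rw [hFζ] at hball
      refine (ball_subset_ball ?_).trans hball
      have h64 : (64 : ℝ) ≤ R (ι m) * (1 - r') ^ 2 / 32 := by
        have := hbigR m
        rw [div_le_iff₀ (by positivity)] at this
        rw [le_div_iff₀ (by norm_num : (0:ℝ) < 32)]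
        linarith
      exact h64
    -- consistency and stability on the disc
    refine harmonicOnNhd_of_latticeHarmonic_limit hρ (hHc.mono hKΩ) hδ hδ0
      (u := fun m => hn (ι m)) ?_ ?_
    · intro m v hv
      exact hharm (ι m) v (hvert m v (ball_subset_closedBall hv))
    · intro ε hε
      -- uniform continuity of `g` on `B̄ r'` and of `Φ⁻¹` on `Φ(B̄ r')`
      have hKt : IsCompact (Φ '' closedBall 0 r') :=
        (isCompact_closedBall (0 : ℂ) r').image_of_continuousOn (hΦd.continuousOn.mono hcb')
      have hKtΩ : Φ '' closedBall 0 r' ⊆ Ω := image_mono hcb'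
      obtain ⟨η, hη, hgu⟩ := Metric.uniformContinuousOn_iff.1
        ((isCompact_closedBall (0 : ℂ) r').uniformContinuousOn_of_continuous (hgc.mono hcb'))
        (ε / 2) (by positivity)
      obtain ⟨θ, hθ, hΦu⟩ := Metric.uniformContinuousOn_iff.1
        (hKt.uniformContinuousOn_of_continuous (hΦi_c.mono hKtΩ)) η hη
      -- eventually: samples within `ε/2` of `g`, and `G` within `θ` of `Φ`, on `B̄ r'`
      have h1 : ∀ᶠ m in atTop, ∀ ζ ∈ closedBall (0 : ℂ) r',
          dist (g ζ) (hn (ι m) (nearestSite 1 (F (ι m) ζ))) < ε / 2 :=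
        hι.eventually (Metric.tendstoUniformlyOn_iff.1
          (hg _ hcb' (isCompact_closedBall _ _)) (ε / 2) (by positivity))
      have h2 : ∀ᶠ m in atTop, ∀ ζ ∈ closedBall (0 : ℂ) r', dist (Φ ζ) (G (ι m) ζ) < θ :=
        (tendsto_add_atTop_nat N₀).eventually (Metric.tendstoUniformlyOn_iff.1
          (hGunif _ hcb' (isCompact_closedBall _ _)) θ hθ)
      filter_upwards [h1, h2] with m hm1 hm2 v hv
      obtain ⟨ζ, hζr', hFζ, hGζ⟩ := hmesh m v hv
      have hζcb : ζ ∈ closedBall (0 : ℂ) r' := mem_closedBall_zero_iff.2 hζr'.le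
      -- the sample at `ζ` is the value at `v`
      have hs := hm1 ζ hζcb
      rw [hFζ, nearestSite_one_toComplex] at hs
      -- `Φ⁻¹` of the mesh point is close to `ζ`
      have hmemK : meshPoint (δ m) v ∈ Φ '' closedBall 0 r' :=
        (hKΦ.trans (image_mono (closedBall_subset_closedBall hr₁r'.le))) hv
      have hΦζ : Φ ζ ∈ Φ '' closedBall 0 r' := mem_image_of_mem Φ hζcb
      have hd1 : dist (meshPoint (δ m) v) (Φ ζ) < θ := by
        rw [← hGζ, dist_comm]
        exact hm2 ζ hζcb
      have hd2 := hΦu _ hmemK _ hΦζ hd1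
      rw [hleft ζ (hcb' hζcb)] at hd2
      have hΦiK : Φi (meshPoint (δ m) v) ∈ closedBall (0 : ℂ) r' :=
        closedBall_subset_closedBall hr₁r'.le (hL'r ⟨_, hv, rfl⟩)
      have hd3 := hgu _ hΦiK _ hζcb hd2
      -- assemble
      rw [Real.dist_eq] at hs hd3
      have hs' : |hn (ι m) v - g ζ| < ε / 2 := by rwa [abs_sub_comm] at hs
      have hd3' : |g ζ - g (Φi (meshPoint (δ m) v))| < ε / 2 := by rwa [abs_sub_comm] at hd3
      have htri := abs_sub_le (hn (ι m) v) (g ζ) (g (Φi (meshPoint (δ m) v)))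
      change |hn (ι m) v - g (Φi (meshPoint (δ m) v))| ≤ ε
      linarith
  -- `g = H ∘ Φ` on the disc, and harmonic ∘ holomorphic is harmonic
  have hcomp : InnerProductSpace.HarmonicOnNhd (fun ζ => H (Φ ζ)) (ball 0 1) :=
    harmonicOnNhd_comp_of_differentiableOn hH hΩ hΦd isOpen_ball (mapsTo_image Φ _)
  intro ζ hζ
  have hev : g =ᶠ[𝓝 ζ] fun ζ => H (Φ ζ) := by
    filter_upwards [isOpen_ball.mem_nhds hζ] with ζ' hζ'
    show g ζ' = g (Φi (Φ ζ'))
    rw [hleft ζ' hζ']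
  exact (InnerProductSpace.harmonicAt_congr_nhds hev).2 (hcomp ζ hζ)

end LSWGrid

end Literature.Probability.LatticeModels

end
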